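import Mathlib
import HarnessLib
import Summits.HubbardSuperconductivity.HubbardSuperconductivity.Theorems.KLProgrammeKLRegimeEngineTowerBlockZeroReadoutFKlEng
import Summits.HubbardSuperconductivity.HubbardSuperconductivity.Theorems.KLProgrammeKLRegimeEngineTowerLevBaseFWgrid

/-!
# Route `KLProgramme` — crux K3 ENGINE (stmt-HubbardSuperconductivity-20437 `KLRegimeEngineV17F2`), stub (b) v2, THE LEVELS PACKAGE (ℓ), located item
# «(ℓ)-READOUT-F», (R332)(D)(α′) RO-3′ CLOSER WITH THE LEVEL-`0` DATUM READ FROM p3's WEIGHTED GRID STEP AT `(Λ_1, F_0)` — `KernelNormsLevels … (K_n) j`,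
# `1 ≤ j ≤ d`, modulo grid-step rows at `(Λ_1, F_0)`, the two imports, and numerics (cell gate-hubbard-kl, seat gate-hubbard-kl-p3 g22; block-`0` twin of
# k3c3-p2 g15's «(ℓ)-BASE-F-WGRID» `klTowerBLevF_le_law_lev_of_doors_of_wgridStep` (…TowerLevBaseFWgrid): `kernelNormsLevels_blockZeroF_klEng`
# (…TowerBlockZeroReadoutFKlEng) ∘ `baseRowsF_of_wgrid_bigraded` / `klTowerMuLevF_one_le_of_baseRows` at `d := 1` ∘ p3 g20's
# `klWtPinnedSumAt_klEffectiveAction_fam_le_of_wgridStep (1 0 jw)` ∘ `wgridBudget_bigraded_le`)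

WHY.  `kernelNormsLevels_blockZeroF_klEng` leaves the level-`0` datum as rows: base bounds `N_b` of `𝒱_1[K_n]` at `F_0` with their floor-unit law at `J = 0`,
and the Chernoff profile of the floor array `klTowerMuLevF … (K_n) 1 1 m`.  Both are ONE object — `𝒱_1 = klTowerInput … 1 1` measured at `F_{1−1}` — i.e. the
tower's BASE DATUM at `d := 1`, and the base-datum suppliers are `d`-generic: p3's `(cutoff, family, rate)`-generic weighted grid step at `(Λ_1, F_0)` gives the
weighted one-pinned sums of `𝒱_1` a literal degree budget, `wgridBudget_bigraded_le` reads it bi-graded (`≤ ε_x^{2p−1}·A_g·P_g^p·|U|^{p−1}`, `p ≥ 3`),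
`baseRowsF_of_wgrid_bigraded (d := 1)` turns it into `N_b`, `hcar` and the discounted unit law `N_b/unitF(0) ≤ (A_g/Klam²/B²)·λ^{p−1}·P_g^p` (`2^{7·0} = 8^0 = 1`),
and `klTowerMuLevF_one_le_of_baseRows (d := 1)` gives the profile `klTowerMuLevF … 1 1 m ≤ 27⁵·A_b′·λ^{m−1}·Q_b^m` (`m ≥ 3`), whence the Chernoff rows with
`A′ = 27⁵·W·A_b′`, `Q′ = Z·Q_b`, `ι₃ = A′·Q′³` (pinned by equations).  So the `1 ≤ j ≤ d` levels of stub (b)'s clause on `K_n` now take the SAME input class as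
RO-3's level `0` — grid-step rows at a cutoff (`Λ_1`) read by the family `F_0` (Gram / weighted rows of `S_{4M}ᵀC^{K_n}_{>Λ_1}S_{4M}`: …EngineScaleCutoff* rows,
generic in the cutoff; weighted overlap rows of `E(F_0[K_n])·S_{4M}`: the klE4X0 class) — plus the degree-`2`/`4` imports `ι₁, ι₂`, the five smallness rows, the
`CE` threshold, the caps, the six-leg cell, and `Z^{K_n}_{Λ_1} ≠ 0`.  No grid row at `(Λ_j, F_j)`, `1 ≤ j < d`, remains.

* **`kernelNormsLevels_blockZeroF_klEng_of_wgridStep (d c″)`**.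
Composition of landed theorems and real algebra; nothing about the model is asserted beyond them; nothing asserts (ℓ), any stub, K3 or superconductivity.
References: BGM 2006 §2.8 (2.76)–(2.84), (2.93)–(2.98), Lemma 2.5, §3 (3.2)–(3.8) [cite: BenfattoGiulianiMastropietro2006]; Pedra–Salmhofer 2008 Thm 2.4
[cite: PedraSalmhofer2008].
-/

noncomputable section

namespace Summit.HubbardSuperconductivity.HubbardSuperconductivity.Theorems.EngineV8

set_option linter.dupNamespace false -- summit = problem name (single-conjunct summit), D-0017

open Classical
open Real Finset Literature.MathematicalPhysics.QuantumLattice Literature.Probability.LatticeModels GrassmannAlgebra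
open Literature.Probability.LatticeModels.BattleFederbush
open Literature.MathematicalPhysics.QuantumLattice.FermiRG
open Summit.HubbardSuperconductivity.HubbardSuperconductivity.Theorems.KLProgrammeLegKernels
open Summit.HubbardSuperconductivity.HubbardSuperconductivity.Theorems.KLRegimeSplit
open Summit.HubbardSuperconductivity.HubbardSuperconductivity.Theorems.KLRegimeWick
open Summit.HubbardSuperconductivity.HubbardSuperconductivity.Theorems.TorusFourierL2
open Summit.HubbardSuperconductivity.HubbardSuperconductivity.Theorems.DispersionFlow

variable {L M : ℕ} [NeZero L] [NeZero M]

set_option maxHeartbeats 400000 in -- one ~80-binder composition + the grid-step budget algebra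
/-- **`KernelNormsLevels` AT A LEVEL `1 ≤ j ≤ d` OF BLOCK `0` ON THE FLOW FRAME, THE LEVEL-`0` DATUM READ FROM p3's WEIGHTED GRID STEP AT `(Λ_1, F_0)`**
((α′) RO-3′ closer, wgrid form): `kernelNormsLevels_blockZeroF_klEng` with its base rows and Chernoff rows DISCHARGED from the grid-step hypotheses at the
cutoff `Λ_1`, analysis family `F_0`, rate `jw` (derived constants and the choices `A_b = A_g/Klam²`, `Q_b = P_g`, `A_b′ = A_b/B²`, `A′ = 27⁵·W·A_b′`, `Q′ = Z·Q_b`,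
`ι₃ = A′·Q′³` are equational binders — instantiate with `rfl`).  See the module docstring.
[cite: BenfattoGiulianiMastropietro2006, §2.8 (2.83), (2.93)-(2.98), Lemma 2.5 (2.98), §3 (3.2)-(3.8)] -/
theorem kernelNormsLevels_blockZeroF_klEng_of_wgridStep (d : ℕ) (c'' : ℝ) (hc'' : 0 < c'') :
    ∃ Cinc Dinc : ℝ, 0 < Cinc ∧ 1 ≤ Dinc ∧
    ∀ R : RenConsts, R.WF2 → ∃ c₃' : ℝ, 0 < c₃' ∧ ∃ U₀' : ℝ, 0 < U₀' ∧
      ∃ Cκ Cb CJ : ℝ, 0 < Cκ ∧ 0 < Cb ∧ 0 < CJ ∧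
      ∀ (G : GeoConsts) (P : SplitConsts) (Qh : EngConsts) (c : ℝ), P.WF → 0 < c → c ≤ klEngC₃6 P R → c ≤ c₃' →
      ∀ μ ∈ klWindowC, ∀ U : ℝ, 0 < U → U ≤ klEngU₀9 P R c → U ≤ U₀' → c'' * U ≤ 1 → ∀ β : ℝ, klBetaMin ≤ β → β ≤ Real.exp (c / U ^ 2) →
      ∀ (L M : ℕ) [NeZero L] [NeZero M], klEngL₃ β U ≤ L → klEngM₃ β U L ≤ M →
      ∀ n : ℕ, 1 ≤ n → n ≤ nScales β + 1 → IsKLRegime U c (-(n : ℤ)) →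
        HistP klPredsV17F2 L M G P Qh R β U μ 0 n → FrameOK R U (nScales β) μ (klFlowFrameU L M β U μ n) →
        (∀ m, 1 ≤ m → m < n → FlowPieceOscAt L M c'' β U μ m) →
      -- the read-out level `1 ≤ j ≤ d` of block `0`, the degree cap
      ∀ j D : ℕ, 1 ≤ j → j ≤ d → j ≤ n → 3 ≤ D →
      -- the partition function at `Λ_1` on the flow frame
      hubbardEffPartitionFnCT L M β U μ 0 (klFlowFrameU L M β U μ n) (klScale klE0 1) ≠ 0 →
      ∀ (B : ℝ), 1 ≤ B →
      -- p3's weighted grid step hypotheses at the cutoff `Λ_1`, analysis family `F_0`, rate `jw`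
      ∀ (jw : ℕ) (κ : ℝ), 0 < κ →
        IsGramBoundedR ((hubbardGridSub L M β (2 * (2 * M))).transpose * hubbardCovAboveCT L M β μ 0 (klFlowFrameU L M β U μ n) (klScale klE0 1) *
          hubbardGridSub L M β (2 * (2 * M))) κ →
      ∀ (αw : ℝ), 0 < αw →
        (∀ X, ∑ Y, ‖((hubbardGridSub L M β (2 * (2 * M))).transpose * hubbardCovAboveCT L M β μ 0 (klFlowFrameU L M β U μ n) (klScale klE0 1) *
          hubbardGridSub L M β (2 * (2 * M))) X Y‖ * gridLabelWt L (2 * (2 * M)) β {gridLegPos X, gridLegPos Y} ≤ αw) →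
        (∀ Y, ∑ X, ‖((hubbardGridSub L M β (2 * (2 * M))).transpose * hubbardCovAboveCT L M β μ 0 (klFlowFrameU L M β U μ n) (klScale klE0 1) *
          hubbardGridSub L M β (2 * (2 * M))) X Y‖ * gridLabelWt L (2 * (2 * M)) β {gridLegPos X, gridLegPos Y} ≤ αw) →
      ∀ (ρ : ℝ), 0 < ρ →
        Real.exp 1 * αw * normV (GridLeg (GridPoint L (2 * (2 * M)))) κ ρ
          (fun m' : ℕ => if m' = 1 then |β| / (2 * (2 * M) : ℕ) * ∑ z : TorusSite 2 L, ‖framePosKernel L (klFlowFrameU L M β U μ n) z‖ * (1 + torusSiteDist z 0)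
            else if m' = 2 then |U| * |β| / (2 * (2 * M) : ℕ) else 0) / κ ^ 2 < 1 →
      ∀ (crw ccw : ℝ), 0 < crw → 0 < ccw →
        (∀ X'' : SpaceTimeIdx L M × SectorLeg (sectorCount 0), ∑ X' : GridLeg (GridPoint L (2 * (2 * M))),
          ‖(sectorAnalysisMatrix L M β (klAnisoFamily L M β μ (klFlowFrameU L M β U μ n) klE0 0) * hubbardGridSub L M β (2 * (2 * M))) X'' X'‖ *
            gridLabelWt L (2 * (2 * M)) β {latticeLegPos (2 * (2 * M)) X'', gridLegPos X'} ≤ crw) →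
        (∀ X' : GridLeg (GridPoint L (2 * (2 * M))), ∑ X'' : SpaceTimeIdx L M × SectorLeg (sectorCount 0),
          ‖(sectorAnalysisMatrix L M β (klAnisoFamily L M β μ (klFlowFrameU L M β U μ n) klE0 0) * hubbardGridSub L M β (2 * (2 * M))) X'' X'‖ *
            gridLabelWt L (2 * (2 * M)) β {latticeLegPos (2 * (2 * M)) X'', gridLegPos X'} ≤ ccw) →
      -- the derived base constants (equational binders)
      ∀ (nV cF cg Ag Pg : ℝ),
        nV = normV (GridLeg (GridPoint L (2 * (2 * M)))) κ ρ
          (fun m' : ℕ => if m' = 1 then |β| / (2 * (2 * M) : ℕ) * ∑ z : TorusSite 2 L, ‖framePosKernel L (klFlowFrameU L M β U μ n) z‖ * (1 + torusSiteDist z 0)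
            else if m' = 2 then |U| * |β| / (2 * (2 * M) : ℕ) else 0) →
        cF = (Real.exp 2 * (κ + ρ)) ^ (2 * 2) * (|β| / (2 * (2 * M) : ℕ)) → cg = Real.exp 1 * αw * cF / κ ^ 2 →
        Ag = crw * Real.exp 1 * cF / (ccw * cg ^ 2) → Pg = ccw ^ 2 * cg / (ρ ^ 2 * (1 - Real.exp 1 * αw * nV / κ ^ 2)) →
      ∀ (Ab Qb Ab' : ℝ), Ab = Ag / P.Klam ^ 2 → Qb = Pg → Ab' = Ab / B ^ 2 →
      -- the block-`0` kit cap at the input label set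
      Fintype.card (SpaceTimeIdx L M × SectorLeg (sectorCount 0)) / 2 ≤ D →
      -- the thick-block data DISCHARGED: the four constants pinned, then the law's six names pinned (equational binders)
      ∀ (κb αb crb ccb : ℝ), κb = Real.sqrt (2 * Cκ * klE0) → αb = Cb * ((M : ℝ) / β) * (4 : ℝ) ^ d / klE0 →
        crb = 81 * CJ * M / β → ccb = 162 * CJ * M / β →
      ∀ (W Z σ Φ ψ τ : ℝ), W = 64 * (27 : ℝ) ^ 4 * exp 2 * crb / ccb → Z = exp 4 * ccb ^ 2 * imagTimeWeight β M ^ 2 / 8 →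
        σ = κb ^ 2 / (exp 4 * ccb ^ 2) → Φ = 9 * αb * ccb / ((27 : ℝ) ^ 5 * exp 1 * κb ^ 2 * crb) → ψ = exp 4 * ccb ^ 2 / κb ^ 2 →
        τ = exp 2 * κb ^ 2 / ccb ^ 2 →
      -- the profile PINNED from the base datum (`A′ = 27⁵·W·A_b′`, `Q′ = Z·Q_b`, `ι₃ = A′·Q′³`) and the two imports (degrees 2 and 4 of `𝒱_1` at `F_0`)
      ∀ (A' Q' ι₃ ι₁ ι₂ : ℝ), A' = (27 : ℝ) ^ 5 * W * Ab' → Q' = Z * Qb → ι₃ = A' * Q' ^ 3 →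
      W * Z ^ 1 * klTowerMuLevF L M β U μ (klFlowFrameU L M β U μ n) 1 1 1 ≤ ι₁ * (B * epsCoupling P U j) →
      W * Z ^ 2 * klTowerMuLevF L M β U μ (klFlowFrameU L M β U μ n) 1 1 2 ≤ ι₂ * (B * epsCoupling P U j) →
      -- the five smallness rows at `(A′, Q′, λ)` (numerics)
      4 * σ * (B * epsCoupling P U j) * Q' < 1 → 2 * (B * epsCoupling P U j) * τ * Q' ≤ 1 → exp 1 * τ * (B * epsCoupling P U j) * Q' < 1 →
      Φ * (τ * (ι₁ * (B * epsCoupling P U j) + ι₂ / (2 * Q') + ι₃ / (4 * Q' ^ 2) + A' * Q' / 4)) < 1 →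
      Φ * (exp 1 * τ * (ι₁ * (B * epsCoupling P U j)) + (exp 1 * τ) ^ 2 * (ι₂ * (B * epsCoupling P U j)) +
          (exp 1 * τ) ^ 3 * (ι₃ * (B * epsCoupling P U j) ^ 2) +
        A' * (exp 1 * τ * Q') * ((exp 1 * τ * (B * epsCoupling P U j) * Q') ^ 3 / (1 - exp 1 * τ * (B * epsCoupling P U j) * Q'))) < 1 →
      -- the read-out constants (equational binders), the public constant's threshold, the field cap, the six-leg cell at level `j`
      ∀ (Aro Qro Qtot Atot : ℝ), Aro = Cinc * Ab' → Qro = Dinc * Qb → Qtot = Dinc * max 1 (max Qro (max (4 * Q') (2 * τ * ψ * Q'))) →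
        Atot = Aro + Cinc * (A' * (4 * σ * (B * epsCoupling P U j) * Q' / (1 - 4 * σ * (B * epsCoupling P U j) * Q')) +
          exp 1 * (τ * (ι₁ * (B * epsCoupling P U j) + ι₂ / (2 * Q') + ι₃ / (4 * Q' ^ 2) + A' * Q' / 4)) *
            (Φ * (τ * (ι₁ * (B * epsCoupling P U j) + ι₂ / (2 * Q') + ι₃ / (4 * Q' ^ 2) + A' * Q' / 4)) /
              (1 - Φ * (τ * (ι₁ * (B * epsCoupling P U j) + ι₂ / (2 * Q') + ι₃ / (4 * Q' ^ 2) + A' * Q' / 4)))) / (2 * τ * Q')) →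
      ∀ Qe : EngConsts, Qtot * imagTimeWeight β M ^ 2 * B * max 1 (Atot / imagTimeWeight β M) ≤ Qe.CE →
      Fintype.card (HubbardFieldIdx L M) ≤ 2 * D + 1 →
      (∀ Ωe : Fin (2 * 3) → Option (SectorLeg (sectorCount j)), levelCount Ωe = 1 →
        klAnisoLegKernelNormAt L M β U μ (klFlowFrameU L M β U μ n) klE0 j (2 * 3) Ωe ≤ Qe.CE ^ 3 * (epsCoupling P U j) ^ 2 * (2 : ℝ) ^ ((4 : ℤ) * j)) →
      KernelNormsLevels L M P Qe β U μ (klFlowFrameU L M β U μ n) j := by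
  obtain ⟨Cinc, Dinc, hCinc, hDinc, hF⟩ := kernelNormsLevels_blockZeroF_klEng d c'' hc''
  refine ⟨Cinc, Dinc, hCinc, hDinc, fun R hR2 => ?_⟩
  obtain ⟨c₃, hc₃, U₀, hU₀, Cκ, Cb, CJ, hCκ, hCb, hCJ, hF'⟩ := hF R hR2
  refine ⟨c₃, hc₃, U₀, hU₀, Cκ, Cb, CJ, hCκ, hCb, hCJ, ?_⟩
  intro G P Qh c hP hc hc6 hc₃' μ hμ U hU hU9 hU₀' hcU β hβmin hβc L M _ _ hL3 hM3 n hn1 hnN hreg hhist hfr hosc j D hj1 hjd hjn hD3 hZ1 B hB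
    jw κ hκ hGB αw hαw hrow hcol ρ hρ hθ crw ccw hcrw hccw hrow' hcol' nV cF cg Ag Pg hnV hcF hcg hAg hPg Ab Qb Ab' hAb hQb hAb' hDcap
    κb αb crb ccb hκb hαb hcrb hccb W Z σ Φ ψ τ hW hZ hσ hΦ hψ hτ A' Q' ι₃ ι₁ ι₂ hA' hQ' hι₃ himp₁ himp₂ hx₁ hx₂ hx₃ hy hθ'
    Aro Qro Qtot Atot hAro hQro hQtot hAtot Qe hCE hcard hsix
  set K : TrigPolyC4v := klFlowFrameU L M β U μ n with hKdef
  have hβ : 0 < β := KLRegimeSplit.pos_of_klBetaMin_le hβmin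
  have hε : 0 ≤ imagTimeWeight β M := imagTimeWeight_nonneg hβ.le M
  have hM0 : (0 : ℝ) < M := Nat.cast_pos.2 (Nat.pos_of_ne_zero (NeZero.ne M))
  have hK1 : 1 ≤ P.Klam := hP.1
  have hK0 : 0 < P.Klam := lt_of_lt_of_le one_pos hK1
  have hB0 : 0 < B := lt_of_lt_of_le one_pos hB
  have hBK : 1 ≤ B * P.Klam := one_le_mul_of_one_le_of_one_le hB hK1
  have hεj : 0 < epsCoupling P U j := by
    unfold epsCoupling
    have : 0 < |U| + U ^ 2 * (j : ℝ) := by positivity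
    positivity
  set lam : ℝ := B * epsCoupling P U j with hlamdef
  have hlam : 0 < lam := mul_pos hB0 hεj
  have hle : B * P.Klam * |U| ≤ lam := by
    rw [hlamdef]
    unfold epsCoupling
    have h1 : |U| ≤ |U| + U ^ 2 * (j : ℝ) := le_add_of_nonneg_right (by positivity)
    calc B * P.Klam * |U| = B * (P.Klam * |U|) := by ring
      _ ≤ B * (P.Klam * (|U| + U ^ 2 * (j : ℝ))) := mul_le_mul_of_nonneg_left (mul_le_mul_of_nonneg_left h1 hK0.le) hB0.le
  -- (1) p3's literal degree budget at `(Λ_1, F_0)` and its bi-graded reading (verbatim as …TowerLevBaseFWgrid, at `d := 1`)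
  have hMpos : (0 : ℝ) < (2 * (2 * M) : ℕ) := by
    have := NeZero.ne M
    exact_mod_cast (by omega : 0 < 2 * (2 * M))
  have hθw : Real.exp 1 * αw * nV / κ ^ 2 < 1 := by rw [hnV]; exact hθ
  have hnV0 : 0 ≤ nV := by
    rw [hnV]
    refine normV_nonneg hκ.le hρ.le (fun m' => ?_)
    split_ifs
    · exact mul_nonneg (by positivity) (sum_nonneg fun z _ => mul_nonneg (norm_nonneg _)
        (add_nonneg zero_le_one (by unfold torusSiteDist; exact Nat.cast_nonneg _)))
    · positivity
    · exact le_rfl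
  set f : ℝ := (Real.exp 2 * (κ + ρ)) ^ (2 * 2) * (|U| * |β| / (2 * (2 * M) : ℕ)) with hfdef
  have hf0 : 0 ≤ f := by positivity
  have hcF0 : 0 < cF := by rw [hcF]; have := abs_pos.2 hβ.ne'; positivity
  have hfu : f = cF * |U| := by rw [hfdef, hcF]; ring
  have h1θ : 0 < 1 - Real.exp 1 * αw * nV / κ ^ 2 := sub_pos.2 hθw
  obtain ⟨Nlit, hNlit⟩ : ∃ Nlit : ℕ → ℝ, Nlit = fun m =>
      if m = 2 then imagTimeWeight β M ^ (2 - 1) * (crw * ccw ^ (2 - 1) * (ρ⁻¹ ^ 2 * (Real.exp 1 * nV) / (1 - Real.exp 1 * αw * nV / κ ^ 2)))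
      else if Even m ∧ 4 ≤ m then
        imagTimeWeight β M ^ (2 * (m / 2) - 1) * (crw * ccw ^ (2 * (m / 2) - 1) *
          (ρ⁻¹ ^ (2 * (m / 2)) * (Real.exp 1 * f) * (Real.exp 1 * αw * f / κ ^ 2) ^ (m / 2 - 2) / (1 - Real.exp 1 * αw * nV / κ ^ 2) ^ (m / 2)))
      else 0 := ⟨_, rfl⟩
  have hNlit_two : Nlit 2 = imagTimeWeight β M ^ (2 - 1) * (crw * ccw ^ (2 - 1) * (ρ⁻¹ ^ 2 * (Real.exp 1 * nV) / (1 - Real.exp 1 * αw * nV / κ ^ 2))) := by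
    rw [hNlit]; simp
  have hNlit_mul : ∀ p, 2 ≤ p → Nlit (2 * p) = imagTimeWeight β M ^ (2 * p - 1) * (crw * ccw ^ (2 * p - 1) *
      (ρ⁻¹ ^ (2 * p) * (Real.exp 1 * f) * (Real.exp 1 * αw * f / κ ^ 2) ^ (p - 2) / (1 - Real.exp 1 * αw * nV / κ ^ 2) ^ p)) := by
    intro p hp
    have h2 : 2 * p ≠ 2 := by omega
    have hev : Even (2 * p) ∧ 4 ≤ 2 * p := ⟨even_two_mul p, by omega⟩
    rw [hNlit]
    simp only [h2, if_false, hev, and_self, if_true, Nat.mul_div_cancel_left p two_pos]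
  have hNlit0 : ∀ m, 0 ≤ Nlit m := by
    intro m
    rw [hNlit]
    dsimp only
    split_ifs
    · positivity
    · positivity
    · exact le_rfl
  set Nw : ℕ → ℝ := fun p => Nlit (2 * p) with hNwdef
  have hNw0 : ∀ p, 0 ≤ Nw p := fun p => hNlit0 _
  have hp3 := klWtPinnedSumAt_klEffectiveAction_fam_le_of_wgridStep hβ U μ K 1 0 jw hκ hGB hαw hrow hcol hρ hθ hccw.le hrow' hcol'
    Nlit (fun m _ => hNlit0 m) (by rw [hNlit_two, hnV]) (fun p hp => by rw [hNlit_mul p hp, hnV])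
  have hgrid : ∀ p, 1 ≤ p → ∀ (q : Fin (2 * p)) (w : SpaceTimeIdx L M × SectorLeg (sectorCount (1 - 1))),
      klWtPinnedSumAt L M β μ K (1 - 1) jw (2 * p) (klTowerInput L M β U μ K 1 1) q w ≤ Nw p := by
    intro p _ q w
    unfold klTowerInput
    exact hp3 (2 * p) q w
  have hcg0 : 0 < cg := by rw [hcg]; positivity
  have hAg0 : 0 < Ag := by rw [hAg]; positivity
  have hPg0 : 0 < Pg := by rw [hPg]; positivity
  have hbi : ∀ p, 3 ≤ p → Nw p ≤ imagTimeWeight β M ^ (2 * p - 1) * Ag * Pg ^ p * |U| ^ (p - 1) := by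
    intro p hp
    have h := wgridBudget_bigraded_le (crw := crw) (θ := Real.exp 1 * αw * nV / κ ^ 2) hccw.le hρ hκ hαw hθw hcF0 hfu (by omega : 2 ≤ p)
    rw [← hcg, ← hAg, ← hPg] at h
    calc Nw p = Nlit (2 * p) := rfl
      _ = imagTimeWeight β M ^ (2 * p - 1) * (crw * ccw ^ (2 * p - 1) *
          (ρ⁻¹ ^ (2 * p) * (Real.exp 1 * f) * (Real.exp 1 * αw * f / κ ^ 2) ^ (p - 2) / (1 - Real.exp 1 * αw * nV / κ ^ 2) ^ p)) :=
          hNlit_mul p (by omega)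
      _ ≤ imagTimeWeight β M ^ (2 * p - 1) * (Ag * Pg ^ p * |U| ^ (p - 1)) := mul_le_mul_of_nonneg_left h (pow_nonneg hε _)
      _ = imagTimeWeight β M ^ (2 * p - 1) * Ag * Pg ^ p * |U| ^ (p - 1) := by ring
  -- (2) the base rows of `𝒱_1` at `F_0` (`d := 1`), and the profile of the floor array `klTowerMuLevF … 1 1`
  obtain ⟨hNb0, hcar, hlawb⟩ := baseRowsF_of_wgrid_bigraded (L := L) (M := M) hβ U μ K 1 jw Nw hNw0 hgrid hAg0.le hPg0.le hbi hK0 hBK hle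
  have hAb'0 : 0 ≤ Ab' := by rw [hAb', hAb]; positivity
  have hQb0 : 0 ≤ Qb := by rw [hQb]; exact hPg0.le
  have hlawb' : ∀ (t : Fin 5) (p : ℕ), 3 ≤ p → (fun (_ : Fin 5) (p : ℕ) => Nw p) t p / klLevUnitF β M t p 0 ≤ Ab' * lam ^ (p - 1) * Qb ^ p := by
    intro t p hp
    have h := hlawb t p hp
    simp only [Nat.sub_self, Nat.mul_zero, pow_zero, one_mul, div_one] at h
    rw [hAb', hAb, hQb]
    exact h
  have hcar' : ∀ (t : Fin 5) (p : ℕ) (Ωe' : Fin (2 * p) → Option (SectorLeg (sectorCount 0))), levelCount Ωe' = (t : ℕ) + 1 →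
      klLevNormOf L M β μ K 0 (2 * p) (klTowerInput L M β U μ K 1 1) Ωe' ≤ (fun (_ : Fin 5) (p : ℕ) => Nw p) t p := hcar
  have hmuF : ∀ m, 3 ≤ m → klTowerMuLevF L M β U μ K 1 1 m ≤ (27 : ℝ) ^ 5 * Ab' * lam ^ (m - 1) * Qb ^ m := fun m hm =>
    klTowerMuLevF_one_le_of_baseRows hβ U μ K 1 hlam.le hAb'0 hQb0 _ hNb0 hcar' hlawb' hm
  -- positivity of the pinned constants, the profile rows in the law's shape
  have hcrb0 : 0 < crb := by rw [hcrb]; positivity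
  have hccb0 : 0 < ccb := by rw [hccb]; positivity
  have hW0 : 0 < W := by rw [hW]; positivity
  have hZ0 : 0 < Z := by rw [hZ]; exact div_pos (mul_pos (mul_pos (exp_pos 4) (pow_pos hccb0 2)) (pow_pos (imagTimeWeight_pos_of_pos (M := M) hβ) 2)) (by norm_num)
  have hA'0 : 0 ≤ A' := by rw [hA']; positivity
  have hQ'0 : 0 < Q' := by rw [hQ', hQb]; positivity
  have hprof : ∀ m, 4 ≤ m → m ≤ D → W * Z ^ m * klTowerMuLevF L M β U μ K 1 1 m ≤ A' * lam ^ (m - 1) * Q' ^ m := by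
    intro m hm _
    calc W * Z ^ m * klTowerMuLevF L M β U μ K 1 1 m ≤ W * Z ^ m * ((27 : ℝ) ^ 5 * Ab' * lam ^ (m - 1) * Qb ^ m) :=
          mul_le_mul_of_nonneg_left (hmuF m (by omega)) (by positivity)
      _ = A' * lam ^ (m - 1) * Q' ^ m := by rw [hA', hQ', mul_pow]; ring
  have hprof3 : W * Z ^ 3 * klTowerMuLevF L M β U μ K 1 1 3 ≤ ι₃ * lam ^ 2 := by
    calc W * Z ^ 3 * klTowerMuLevF L M β U μ K 1 1 3 ≤ W * Z ^ 3 * ((27 : ℝ) ^ 5 * Ab' * lam ^ (3 - 1) * Qb ^ 3) :=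
          mul_le_mul_of_nonneg_left (hmuF 3 le_rfl) (by positivity)
      _ = ι₃ * lam ^ 2 := by rw [hι₃, hA', hQ', mul_pow]; ring
  -- (3) the block-`0` closer
  exact hF' G P Qh c hP hc hc6 hc₃' μ hμ U hU hU9 hU₀' hcU β hβmin hβc L M hL3 hM3 n hn1 hnN hreg hhist hfr hosc j D hj1 hjd hjn hD3 hZ1
    B Ab' Qb hB hAb'0 hQb0 (fun (_ : Fin 5) (p : ℕ) => Nw p) hNb0 hcar' hlawb' hDcap κb αb crb ccb hκb hαb hcrb hccb W Z σ Φ ψ τ hW hZ hσ hΦ hψ hτ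
    A' Q' ι₁ ι₂ ι₃ hA'0 hQ'0 hprof hprof3 himp₁ himp₂ hx₁ hx₂ hx₃ hy hθ' Aro Qro Qtot Atot hAro hQro hQtot hAtot Qe hCE hcard hsix

end Summit.HubbardSuperconductivity.HubbardSuperconductivity.Theorems.EngineV8

end
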